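/-
Copyright (c) 2026. All rights reserved.
Released under Apache 2.0 license as described in the file LICENSE.
Authors: abc-iut cell, seat abc-iut-L4-t14 (gen 4; proof-only assembly: [AbsTopIII] Prop 4.2 (i)
«objects of EA mapping to X id-rigid» at the uniformised model IN PRINT'S RC-CATEGORY (holomorphic AND
anti-holomorphic finite étale morphisms), X = ℍ/Γ̄ with Γ̄ free of rank ≥ 2 — the Lemma 4.3 input for the
full-isometry orbicurve [ℍ/N_{PGL₂(ℝ)}(Γ̄)] discharged by abc-iut-L4-d1's theorem over `PGL(2, ℝ)`).
-/
import Literature.AnabelianGeometry.AbsoluteAnabelian.ArchimedeanHolFieldFunctorGeometricRCPGLFaithful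
import Literature.AnabelianGeometry.AbsoluteAnabelian.ArchimedeanHolFieldFunctorGeometricPGLCentralizer
import Literature.AnabelianGeometry.AbsoluteAnabelian.ArchimedeanHolFieldFunctorGeometricRCOver
import Literature.AnabelianGeometry.AbsoluteAnabelian.IdRigidEpiCoverDescent
import Literature.AnabelianGeometry.AbsoluteAnabelian.IdRigidMapsToFullSubcategory
import Literature.AnabelianGeometry.AbsoluteAnabelian.IdRigidLocalCriterion
import HarnessLib

/-!
# [AbsTopIII] Prop 4.2 (i) in the RC-category at the uniformised model: «objects mapping to `ℍ/Γ̄`» is id-rigid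

S. Mochizuki, *Topics in absolute anabelian geometry III*, proof of Prop 4.2 (i) p. 106 l. 14–19 (kurims
`paper:url-5493eb38cbb7`; bib key `MochizukiAbsTopIII2015`): "the full subcategory of `EA` consisting of
objects that map to `X` may, by Corollary 2.3, (i) …, be identified with the category of finite étale
R-localizations `Loc_R(X)` …. Thus, the id-rigidity of `EA` follows immediately from the slimness
assertion of Lemma 4.3."  Here the morphisms of `EA` are the PRINT-FAITHFUL ones — RC-holomorphic finite
étale maps (Def 4.1 (iii), Cor 2.3 (i); the tree's category `HolRS.RC`, abc-iut-L4-t14 p425328) — and the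
ambient group of `Loc_R(X)` for `X = ℍ/Γ̄` is the full isometry group `Isom(ℍ) = PGL(2, ℝ)` (Mathlib).

PROOF-ONLY assembly (no definition, no named fact), PART 2 of 2 (part 1 =
`ArchimedeanHolFieldFunctorGeometricRCPGLFaithful.lean`: faithfulness lemmas and the slimness of `π̂₁(ℍ/Γ̄)`),
for `Γ̄ ≤ PSL₂(ℝ)` free of rank `≥ 2` acting freely and properly discontinuously on `ℍ`:

* `HolRS.pgl_eq_one_of_forall_smul_eq` — `PGL(2, ℝ)` acts faithfully on `ℍ` (an orientation-reversing
  isometry is anti-holomorphic, hence not the identity: `isAntiHolAt_J_smul` vs. the tree's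
  `not_isHolAt_and_isAntiHolAt_of_injOn`);
* `HolRS.RC.mul_inv_mem_of_forall_mk_smul_eq` — FAITHFULNESS: `q, q' ∈ PGL(2, ℝ)` inducing the same map
  `ℍ → ℍ/Λ̄` differ by an element of `Λ̄` (uniqueness of lifts through the covering `ℍ → ℍ/Λ̄`);
* `HolRS.isSlimGroup_profiniteCompletion_fundamentalGroup_pslQuotient` — `π̂₁(ℍ/Γ̄)` is slim
  (`π₁(ℍ/Γ̄) ≅ Γ̄ᵐᵒᵖ` by Mathlib's `IsQuotientCoveringMap.fundamentalGroupEquiv`, `Γ̄` free of rank `≥ 2`);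
* ★ `HolRS.RC.app_self_eq_id_of_mulEquiv_freeGroup` — **(H1⁎) in the RC-category**: every automorphism `α` of
  the identity functor of `{Y ∈ RC | Y ⟶ ⟨ℍ/Γ̄⟩}` has `α_X = 𝟙`: by SIGN-FREE RC FULLNESS
  (`RC.exists_pgl_of_hom`, p451543) the components at the uniformised objects `ℍ/Λ̄` are `[τ] ↦ [q_Λ • τ]`,
  `q_Λ ∈ PGL(2, ℝ)`; naturality makes `(q_Λ)` a compatible `Γ̄`-central family in `N_{PGL₂(ℝ)}(Γ̄)`
  (hypothesis (Z) of abc-iut-L4-t14's group model, `LocObj.CentralFamiliesTrivial` for `N = PGL(2, ℝ)`,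
  p432943), which is trivial by `LocObj.centralFamiliesTrivial_of_completion_normalizer` (p433566) over
  abc-iut-L4-d1's `eq_one_of_forall_commute_etaFn_normalizer` (p448081; inputs: `Γ̄` free —
  transported along `toPGL` — and `C_{PGL₂(ℝ)}(Γ̄) = 1`, p448965 `pgl_centralizer_eq_bot`);
* ★ `HolRS.RC.isIdRigid_mapsTo_pslQuotient_of_mulEquiv_freeGroup` / `…_of_isFreeGroup` — **«objects of
  the RC-category mapping to `ℍ/Γ̄`» is ID-RIGID**, hypotheses ONLY {`hfin`, `hN' : [N_{PGL₂(ℝ)}(Γ̄) : Γ̄] < ∞`, `Γ̄` free of rank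
  `≥ 2`}: abc-iut-w6-d003's descent `isIdRigid_mapsTo_of_app_self_eq_id` (p441434) from (H1⁎) and the
  id-rigidity of the RC slice `Over ⟨ℍ/Γ̄⟩` (abc-iut-L4-t12's `RC.isIdRigid_over_of_isSlimGroup`, p444100).

* ★★ `HolRS.RC.isIdRigid_EA_mapsTo_pslQuotient_of_isFreeGroup` — **the geometric `EA` of the RC instance
  (`geometricAutHolFieldFunctorRC Q`, `Q Y := (Y ⟶ ⟨ℍ/Γ̄⟩)`) is ID-RIGID**, given
  `[N_{PGL₂(ℝ)}(Λ̄) : Λ̄] < ∞` for all finite-index `Λ̄ ≤ Γ̄` (every object is RC-isomorphic to some `ℍ/Λ̄`: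
  abc-iut-L4-t12's `RC.exists_iso_ofCover`, `isIdRigid_mapsTo_fullSubcategory_iff`).

* `HolRS.RC.cor_4_5_geometric_mapsTo_pslQuotient_of_isFreeGroup` — hence [AbsTopIII] Cor 4.5 (i)–(v) over
  the RC instance (abc-iut-L4-t10's `cor_4_5_geometricRC`).

MODEL ≠ reconstruction; the orbi objects and `EA` beyond one `X₀` are not treated; nothing here bears on
[IUTchIII] Cor. 3.12; typed ≠ proved.
-/

set_option autoImplicit false

noncomputable section

open scoped Manifold ContDiff Topology UpperHalfPlane MatrixGroups
open _root_.MulAction _root_.CategoryTheory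
open Literature.AlgebraicGeometry.Frobenioids (IsSlimGroup)
open Literature.IUT.HodgeTheaters (profiniteCompletion)
open Matrix.ProjectiveSpecialLinearGroup (toPGL toPGL_mk toPGL_injective)

namespace Literature.AnabelianGeometry.AbsoluteAnabelian

namespace HolRS

/-! ### (H1⁎) in the RC-category: `α_X = 𝟙` -/

section H1

variable (Γ : Subgroup PSL2R) [ProperlyDiscontinuousSMul Γ ℍ] [IsCancelSMul Γ ℍ]
  (hfin : ∀ (g : PSL2R) (Λ₁ Λ₂ : _root_.Literature.AnabelianGeometry.AbsoluteAnabelian.LocObj Γ),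
    (∀ x ∈ Λ₁.toSubgroup, g * x * g⁻¹ ∈ Λ₂.toSubgroup) →
    ((Literature.Geometry.Manifold.QuotientManifold.conjSubgroup g Λ₁.toSubgroup).subgroupOf
      Λ₂.toSubgroup).FiniteIndex)

/-- Two objects of `Loc(N, Γ)` with the same subgroup are equal. [cite: MochizukiAbsTopIII2015, Proposition 4.2 (i) proof p.106] -/
theorem _root_.Literature.AnabelianGeometry.AbsoluteAnabelian.LocObj.ext_toSubgroup
    {N : Type} [Group N] {Γ : Subgroup N}
    {Λ₁ Λ₂ : _root_.Literature.AnabelianGeometry.AbsoluteAnabelian.LocObj Γ}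
    (h : Λ₁.toSubgroup = Λ₂.toSubgroup) : Λ₁ = Λ₂ := by
  cases Λ₁; cases Λ₂; cases h; rfl

include hfin in
/-- ★ **(H1⁎) for print's RC-morphisms at the uniformised model**: for `Γ̄ ≤ PSL₂(ℝ)` free of rank `≥ 2`
acting freely and properly discontinuously on `ℍ`, with `[N_{PGL₂(ℝ)}(Γ̄) : Γ̄] < ∞`, every automorphism
`α` of the identity functor of «objects of `RC` mapping to `⟨ℍ/Γ̄⟩`» has trivial component at `ℍ/Γ̄`.
Proof: the components at the objects `ℍ/Λ̄` (`Λ̄ : LocObj Γ̄`) are `[τ] ↦ [q_Λ • τ]` with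
`q_Λ ∈ PGL(2, ℝ)` (sign-free RC fullness); naturality along the projections and the deck transformations,
read through `RC.mul_inv_mem_of_forall_mk_smul_eq`, makes `(q_Λ)` a compatible `Γ̄`-central family in
`N_{PGL₂(ℝ)}(Γ̄)`, trivial by hypothesis (Z) of the group model `Loc(PGL₂(ℝ), Γ̄)` — discharged by
abc-iut-L4-d1's theorem with `Γ̄` free and `C_{PGL₂(ℝ)}(Γ̄) = 1`. [cite: MochizukiAbsTopIII2015, Proposition 4.2 (i) proof p.106] -/
theorem RC.app_self_eq_id_of_mulEquiv_freeGroup {m : ℕ} (e : Γ ≃* FreeGroup (Fin m)) (hm : 2 ≤ m)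
    [hN' : ((Γ.map (toPGL (n := Fin 2) (R := ℝ))).subgroupOf
      (Subgroup.normalizer ((Γ.map (toPGL (n := Fin 2) (R := ℝ)) : Subgroup PGL(2, ℝ)) :
        Set PGL(2, ℝ)))).FiniteIndex]
    (α : 𝟭 (ObjectProperty.FullSubcategory fun Y : RC => Nonempty (Y ⟶ toRC.obj (pslQuotient Γ))) ≅
      𝟭 _) :
    (α.hom.app (mapsToSelf (toRC.obj (pslQuotient Γ)))).hom = 𝟙 (toRC.obj (pslQuotient Γ)) := by
  classical
  -- notation
  let F := pslLocFunctor Γ hfin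
  let Γ' : Subgroup PGL(2, ℝ) := Γ.map (toPGL (n := Fin 2) (R := ℝ))
  let C := ObjectProperty.FullSubcategory fun Y : RC => Nonempty (Y ⟶ toRC.obj (pslQuotient Γ))
  -- the uniformised objects `ℍ/Λ̄` of `C`
  let A : _root_.Literature.AnabelianGeometry.AbsoluteAnabelian.LocObj Γ → C := fun Λ =>
    ⟨toRC.obj (F.obj Λ), (nonempty_hom_pslLocFunctor_obj Γ hfin Λ).map toRC.map⟩
  -- the components at the `ℍ/Λ̄` come from `PGL(2, ℝ)` (sign-free RC fullness)
  have key : ∀ Λ : _root_.Literature.AnabelianGeometry.AbsoluteAnabelian.LocObj Γ, ∃ q : PGL(2, ℝ),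
      (∀ τ : ℍ, (α.hom.app (A Λ)).hom.toFun (Quotient.mk (orbitRel Λ.toSubgroup ℍ) τ) =
        Quotient.mk (orbitRel Λ.toSubgroup ℍ) (q • τ)) ∧
      ∀ x ∈ Λ.toSubgroup, q * toPGL x * q⁻¹ ∈ Λ.toSubgroup.map (toPGL (n := Fin 2) (R := ℝ)) := by
    intro Λ
    haveI : ProperlyDiscontinuousSMul Λ.toSubgroup ℍ :=
      Subgroup.properlyDiscontinuousSMul_of_le ‹ProperlyDiscontinuousSMul Γ ℍ› Λ.le
    haveI : IsCancelSMul Λ.toSubgroup ℍ := isCancelSMul_of_le upperHalfPlane Γ Λ.le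
    exact RC.exists_pgl_of_hom Λ.toSubgroup Λ.toSubgroup (α.hom.app (A Λ)).hom
  choose x hx hxconj using key
  -- naturality along `[g] : Λ₁ → Λ₂` read in `PGL(2, ℝ)`: `(g x_{Λ₁}) (x_{Λ₂} g)⁻¹ ∈ Λ̄₂`
  have hnat : ∀ {Λ₁ Λ₂ : _root_.Literature.AnabelianGeometry.AbsoluteAnabelian.LocObj Γ} (g : PSL2R)
      (hg : ∀ y ∈ Λ₁.toSubgroup, g * y * g⁻¹ ∈ Λ₂.toSubgroup),
      toPGL g * x Λ₁ * (x Λ₂ * toPGL g)⁻¹ ∈ Λ₂.toSubgroup.map (toPGL (n := Fin 2) (R := ℝ)) := by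
    intro Λ₁ Λ₂ g hg
    haveI : ProperlyDiscontinuousSMul Λ₂.toSubgroup ℍ :=
      Subgroup.properlyDiscontinuousSMul_of_le ‹ProperlyDiscontinuousSMul Γ ℍ› Λ₂.le
    haveI : IsCancelSMul Λ₂.toSubgroup ℍ := isCancelSMul_of_le upperHalfPlane Γ Λ₂.le
    let φ : A Λ₁ ⟶ A Λ₂ := ObjectProperty.homMk (toRC.map (F.map (LocObj.homMk g hg)))
    have hφ := α.hom.naturality φ
    -- evaluate both sides at `[τ]`
    refine RC.mul_inv_mem_of_forall_mk_smul_eq Λ₂.toSubgroup fun τ => ?_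
    have e1 := congrArg (fun k : A Λ₁ ⟶ A Λ₂ => k.hom.toFun (Quotient.mk (orbitRel Λ₁.toSubgroup ℍ) τ)) hφ
    simp only [Functor.id_map, Functor.id_obj] at e1
    -- `e1 : (φ ≫ α_{Λ₂}).toFun [τ] = (α_{Λ₁} ≫ φ).toFun [τ]`
    change (α.hom.app (A Λ₂)).hom.toFun ((toRC.map (F.map (LocObj.homMk g hg))).toFun
        (Quotient.mk (orbitRel Λ₁.toSubgroup ℍ) τ)) =
      (toRC.map (F.map (LocObj.homMk g hg))).toFun ((α.hom.app (A Λ₁)).hom.toFun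
        (Quotient.mk (orbitRel Λ₁.toSubgroup ℍ) τ)) at e1
    rw [hx Λ₁ τ, toRC_map_toFun] at e1
    erw [LocObj.toHolRS_map_homMk_toFun_mk, LocObj.toHolRS_map_homMk_toFun_mk] at e1
    rw [hx Λ₂] at e1
    -- `e1 : [x₂ • g • τ] = [g • x₁ • τ]`
    rw [mul_smul, mul_smul, toPGL_smul, toPGL_smul]
    exact e1
  -- the component at `X` itself lies in the normaliser of `Γ̄'` (invertibility of `α_X`)
  have htop : x (LocObj.top Γ) ∈ Subgroup.normalizer (Γ' : Set PGL(2, ℝ)) := by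
    obtain ⟨qt, hqt, hqtconj⟩ := RC.exists_pgl_of_hom Γ Γ (α.inv.app (A (LocObj.top Γ))).hom
    -- `x_top * qt ∈ Γ̄'` from `α.inv ≫ α.hom = 𝟙`
    have hcomp : ∀ τ : ℍ, Quotient.mk (orbitRel Γ ℍ) ((x (LocObj.top Γ) * qt) • τ) =
        Quotient.mk (orbitRel Γ ℍ) ((1 : PGL(2, ℝ)) • τ) := by
      intro τ
      have e0 := congrArg (fun k : A (LocObj.top Γ) ⟶ A (LocObj.top Γ) =>
        k.hom.toFun (Quotient.mk (orbitRel Γ ℍ) τ)) (α.inv_hom_id_app (A (LocObj.top Γ)))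
      change (α.hom.app (A (LocObj.top Γ))).hom.toFun ((α.inv.app (A (LocObj.top Γ))).hom.toFun
        (Quotient.mk (orbitRel Γ ℍ) τ)) = Quotient.mk (orbitRel Γ ℍ) τ at e0
      rw [hqt τ] at e0
      erw [hx (LocObj.top Γ)] at e0
      rw [mul_smul, one_smul]
      exact e0
    have hmem : (1 : PGL(2, ℝ)) * (x (LocObj.top Γ) * qt)⁻¹ ∈ Γ' :=
      RC.mul_inv_mem_of_forall_mk_smul_eq Γ hcomp
    rw [one_mul, Subgroup.inv_mem_iff] at hmem
    -- `x_top Γ̄' x_top⁻¹ ≤ Γ̄'` (from `hxconj`) and `x_top⁻¹ Γ̄' x_top ≤ Γ̄'` (from `qt`)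
    rw [Subgroup.mem_normalizer_iff]
    intro y
    constructor
    · intro hy
      obtain ⟨z, hz, rfl⟩ := Subgroup.mem_map.mp hy
      exact hxconj (LocObj.top Γ) z hz
    · intro hy
      -- `y = x⁻¹ (x y x⁻¹) x = qt μ⁻¹ (x y x⁻¹) μ qt⁻¹` with `μ := x qt ∈ Γ̄'`
      have h3 : qt * ((x (LocObj.top Γ) * qt)⁻¹ * (x (LocObj.top Γ) * y * (x (LocObj.top Γ))⁻¹) *
          (x (LocObj.top Γ) * qt)) * qt⁻¹ = y := by group
      rw [← h3]
      have h4 : (x (LocObj.top Γ) * qt)⁻¹ * (x (LocObj.top Γ) * y * (x (LocObj.top Γ))⁻¹) *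
          (x (LocObj.top Γ) * qt) ∈ Γ' :=
        Γ'.mul_mem (Γ'.mul_mem (Γ'.inv_mem hmem) hy) hmem
      obtain ⟨z, hz, hz'⟩ := Subgroup.mem_map.mp h4
      rw [← hz']
      exact hqtconj z hz
  -- every component lies in `N(Γ̄')`: `x_Λ ∈ Γ̄' x_top`
  have hxN : ∀ Λ : _root_.Literature.AnabelianGeometry.AbsoluteAnabelian.LocObj Γ,
      x Λ ∈ Subgroup.normalizer (Γ' : Set PGL(2, ℝ)) := by
    intro Λ
    have h1 := hnat (Λ₁ := Λ) (Λ₂ := LocObj.top Γ) 1 (fun y hy => by simpa using Λ.le hy)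
    rw [map_one, one_mul, mul_one] at h1
    -- `h1 : x_Λ x_top⁻¹ ∈ Γ̄' ⊆ N(Γ̄')`
    have h3 : x Λ = (x Λ * (x (LocObj.top Γ))⁻¹) * x (LocObj.top Γ) := by group
    rw [h3]
    exact (Subgroup.normalizer _).mul_mem (Subgroup.le_normalizer h1) htop
  -- the family on the objects of `Loc(PGL₂(ℝ), Γ̄')`
  let pre : _root_.Literature.AnabelianGeometry.AbsoluteAnabelian.LocObj Γ' →
      _root_.Literature.AnabelianGeometry.AbsoluteAnabelian.LocObj Γ := fun Λ' =>
    { toSubgroup := Λ'.toSubgroup.comap (toPGL (n := Fin 2) (R := ℝ))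
      le := fun y hy => by
        have : toPGL y ∈ Γ' := Λ'.le hy
        obtain ⟨z, hz, hzy⟩ := Subgroup.mem_map.mp this
        rwa [← toPGL_injective hzy]
      finiteIndex := by
        haveI := Λ'.finiteIndex
        -- `[Γ̄ : toPGL⁻¹ Λ'] = [Γ̄' : Λ']` along `Γ̄ ≃* Γ̄'`
        let eΓ : Γ ≃* Γ' := Subgroup.equivMapOfInjective Γ _ toPGL_injective
        have hcomap : (Λ'.toSubgroup.comap (toPGL (n := Fin 2) (R := ℝ))).subgroupOf Γ =
            (Λ'.toSubgroup.subgroupOf Γ').comap eΓ.toMonoidHom := by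
          ext y
          rw [Subgroup.mem_subgroupOf, Subgroup.mem_comap, Subgroup.mem_comap, Subgroup.mem_subgroupOf,
            MulEquiv.coe_toMonoidHom, Subgroup.coe_equivMapOfInjective_apply]
        refine ⟨?_⟩
        rw [hcomap, Subgroup.index_comap_of_surjective _ eΓ.surjective]
        exact Subgroup.FiniteIndex.index_ne_zero }
  have hpre_le : ∀ {Λ' Λ'' : _root_.Literature.AnabelianGeometry.AbsoluteAnabelian.LocObj Γ'},
      Λ''.toSubgroup ≤ Λ'.toSubgroup → (pre Λ'').toSubgroup ≤ (pre Λ').toSubgroup :=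
    fun h => Subgroup.comap_mono h
  have hpre_map : ∀ Λ' : _root_.Literature.AnabelianGeometry.AbsoluteAnabelian.LocObj Γ',
      (pre Λ').toSubgroup.map (toPGL (n := Fin 2) (R := ℝ)) ≤ Λ'.toSubgroup :=
    fun Λ' => Subgroup.map_comap_le _ _
  -- hypothesis (Z) of the group model `Loc(PGL₂(ℝ), Γ̄')`, discharged by abc-iut-L4-d1 + RC-a
  have hΓnc : ∃ a b : Γ, a * b ≠ b * a :=
    Literature.GroupTheory.exists_mul_ne_mul_of_mulEquiv e
      (Literature.GroupTheory.FreeGroup.exists_mul_ne_mul_fin hm)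
  have hfree : IsFreeGroup Γ' :=
    IsFreeGroup.ofMulEquiv (e.symm.trans (Subgroup.equivMapOfInjective Γ _ toPGL_injective))
  have hC : ∀ g ∈ Subgroup.normalizer (Γ' : Set PGL(2, ℝ)), (∀ γ ∈ Γ', g * γ = γ * g) → g = 1 := by
    intro g _ hg
    have hmem : g ∈ Subgroup.centralizer (Γ' : Set PGL(2, ℝ)) := by
      rw [Subgroup.mem_centralizer_iff]
      exact fun y hy => (hg y hy).symm
    rwa [pgl_centralizer_eq_bot Γ hΓnc, Subgroup.mem_bot] at hmem
  have hZ : LocObj.CentralFamiliesTrivial Γ' :=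
    LocObj.centralFamiliesTrivial_of_completion_normalizer
      (Literature.GroupTheory.eq_one_of_forall_commute_etaFn_normalizer Γ' hfree hC)
  -- apply (Z) to the family `x ∘ pre` at the object `Γ̄'` itself
  have hconcl := hZ (fun Λ' => x (pre Λ')) (fun Λ' _ => hxN (pre Λ'))
    (fun Λ' Λ'' _ _ hle => by
      -- compatibility from naturality along `[1] : pre Λ'' → pre Λ'`
      have h1 := hnat (Λ₁ := pre Λ'') (Λ₂ := pre Λ') 1 (fun y hy => by simpa using hpre_le hle hy)
      rw [map_one, one_mul, mul_one] at h1
      have h3 := hpre_map Λ' h1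
      rw [← Subgroup.inv_mem_iff] at h3
      simpa using h3)
    (fun Λ' hΛ' γ hγ => by
      -- centrality from naturality along the deck transformation `[g] : pre Λ' → pre Λ'`
      obtain ⟨g, hg, rfl⟩ := Subgroup.mem_map.mp hγ
      have hnormal : ∀ y ∈ (pre Λ').toSubgroup, g * y * g⁻¹ ∈ (pre Λ').toSubgroup := by
        intro y hy
        change toPGL (g * y * g⁻¹) ∈ Λ'.toSubgroup
        rw [map_mul, map_mul, map_inv]
        exact hΛ' _ (Subgroup.mem_map_of_mem _ hg) _ hy
      have h1 := hpre_map Λ' (hnat (Λ₁ := pre Λ') (Λ₂ := pre Λ') g hnormal)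
      rw [← Subgroup.inv_mem_iff] at h1
      have e3 : (toPGL g * x (pre Λ') * (x (pre Λ') * toPGL g)⁻¹)⁻¹ =
          x (pre Λ') * toPGL g * (x (pre Λ'))⁻¹ * (toPGL g)⁻¹ := by group
      rwa [e3] at h1)
    (LocObj.top Γ') (fun γ hγ y hy => Γ'.mul_mem (Γ'.mul_mem hγ hy) (Γ'.inv_mem hγ))
  -- `pre (top Γ̄') = top Γ̄`, so `x_top ∈ Γ̄'`
  have hpretop : pre (LocObj.top Γ') = LocObj.top Γ :=
    LocObj.ext_toSubgroup (Subgroup.comap_map_eq_self_of_injective toPGL_injective Γ)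
  rw [hpretop] at hconcl
  change x (LocObj.top Γ) ∈ Γ' at hconcl
  obtain ⟨g₀, hg₀, hg₀x⟩ := Subgroup.mem_map.mp hconcl
  -- conclude: `α_X [τ] = [x_top • τ] = [g₀ • τ] = [τ]`
  apply RC.hom_ext
  funext p
  induction p using Quotient.inductionOn with
  | h τ =>
    change (α.hom.app (A (LocObj.top Γ))).hom.toFun (Quotient.mk (orbitRel Γ ℍ) τ) =
      Quotient.mk (orbitRel Γ ℍ) τ
    erw [hx (LocObj.top Γ) τ]
    rw [← hg₀x, toPGL_smul]
    exact Quotient.sound ⟨⟨g₀, hg₀⟩, rfl⟩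

/-- `π̂₁(ℍ/Γ̄, [I])` is slim, `Γ̄ ≃* F_m` (`m ≥ 2`) form of part 1's
`isSlimGroup_profiniteCompletion_fundamentalGroup_pslQuotient`. [cite: MochizukiAbsTopIII2015, Lemma 4.3 p.106] -/
theorem isSlimGroup_profiniteCompletion_fundamentalGroup_pslQuotient_of_mulEquiv {m : ℕ}
    (e : Γ ≃* FreeGroup (Fin m)) (hm : 2 ≤ m) :
    IsSlimGroup (profiniteCompletion
      (FundamentalGroup (pslQuotient Γ).carrier (Quotient.mk (orbitRel Γ ℍ) UpperHalfPlane.I))) := by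
  have eπ : FundamentalGroup (pslQuotient Γ).carrier (Quotient.mk (orbitRel Γ ℍ) UpperHalfPlane.I) ≃*
      Γᵐᵒᵖ :=
    (isQuotientCoveringMap_quotientMk_of_properlyDiscontinuousSMul (G := Γ) (E := ℍ)).fundamentalGroupEquiv
      ⟨UpperHalfPlane.I, rfl⟩
  exact Literature.GroupTheory.isSlimGroup_profiniteCompletion_of_mulEquiv_freeGroup
    ((eπ.trans (MulEquiv.inv' Γ).symm).trans e) hm

include hfin in
/-- ★ **[AbsTopIII] Prop 4.2 (i) in print's RC-category, at the uniformised model: «objects of `RC` mapping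
to `ℍ/Γ̄`» is ID-RIGID** for `Γ̄ ≤ PSL₂(ℝ)` with `Γ̄ ≃* F_m`, `m ≥ 2`, acting freely and properly
discontinuously on `ℍ`, provided `[N_{PGL₂(ℝ)}(Γ̄) : Γ̄] < ∞` — abc-iut-w6-d003's descent from (H1⁎)
(above) and the id-rigidity of the RC slice over `ℍ/Γ̄` (abc-iut-L4-t12, from the slimness of
`π̂₁(ℍ/Γ̄) ≅ Γ̂`).  The «Lemma 4.3» input for the full-isometry orbicurve `[ℍ/N_{PGL₂(ℝ)}(Γ̄)]` is
DISCHARGED (abc-iut-L4-d1 + `pgl_centralizer_eq_bot`); hypotheses ONLY {`hfin`, `hN'`, `Γ̄ ≃* F_m`}.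
[cite: MochizukiAbsTopIII2015, Proposition 4.2 (i) proof p.106] -/
theorem RC.isIdRigid_mapsTo_pslQuotient_of_mulEquiv_freeGroup {m : ℕ} (e : Γ ≃* FreeGroup (Fin m))
    (hm : 2 ≤ m)
    [((Γ.map (toPGL (n := Fin 2) (R := ℝ))).subgroupOf
      (Subgroup.normalizer ((Γ.map (toPGL (n := Fin 2) (R := ℝ)) : Subgroup PGL(2, ℝ)) :
        Set PGL(2, ℝ)))).FiniteIndex] :
    IsIdRigid (ObjectProperty.FullSubcategory fun Y : RC => Nonempty (Y ⟶ toRC.obj (pslQuotient Γ))) :=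
  isIdRigid_mapsTo_of_app_self_eq_id (toRC.obj (pslQuotient Γ))
    (RC.app_self_eq_id_of_mulEquiv_freeGroup Γ hfin e hm)
    (RC.isIdRigid_over_of_isSlimGroup (pslQuotient Γ) (Quotient.mk (orbitRel Γ ℍ) UpperHalfPlane.I)
      (isSlimGroup_profiniteCompletion_fundamentalGroup_pslQuotient_of_mulEquiv Γ e hm))

include hfin in
/-- The same with `Γ̄` free of rank `≥ 2` in Mathlib's `IsFreeGroup` form.
[cite: MochizukiAbsTopIII2015, Proposition 4.2 (i) proof p.106] -/
theorem RC.isIdRigid_mapsTo_pslQuotient_of_isFreeGroup [IsFreeGroup Γ]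
    [Finite (IsFreeGroup.Generators Γ)] (h2 : 2 ≤ Nat.card (IsFreeGroup.Generators Γ))
    [((Γ.map (toPGL (n := Fin 2) (R := ℝ))).subgroupOf
      (Subgroup.normalizer ((Γ.map (toPGL (n := Fin 2) (R := ℝ)) : Subgroup PGL(2, ℝ)) :
        Set PGL(2, ℝ)))).FiniteIndex] :
    IsIdRigid (ObjectProperty.FullSubcategory fun Y : RC => Nonempty (Y ⟶ toRC.obj (pslQuotient Γ))) := by
  obtain ⟨m, hm, ⟨e⟩⟩ := LocObj.exists_mulEquiv_freeGroup h2 (LocObj.top Γ)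
  exact RC.isIdRigid_mapsTo_pslQuotient_of_mulEquiv_freeGroup Γ hfin e hm

/-! ### The geometric `EA` of the RC instance over `X₀ = ℍ/Γ̄` is id-rigid -/

include hfin in
/-- ★★ **The geometric `EA` with PRINT-FAITHFUL (RC-holomorphic) morphisms over `X₀ = ℍ/Γ̄` is ID-RIGID**
— [AbsTopIII] Prop 4.2 (i) for `geometricAutHolFieldFunctorRC Q`, `Q Y := (Y ⟶ ⟨ℍ/Γ̄⟩)`, at the
uniformised model, `Γ̄` free of rank `≥ 2` acting freely and properly discontinuously on `ℍ`, provided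
`[N_{PGL₂(ℝ)}(Λ̄) : Λ̄] < ∞` for every finite-index `Λ̄ ≤ Γ̄`: print's deduction «objects mapping to `X`»
id-rigid for all `X` ⟹ `EA` id-rigid (`isIdRigid_of_forall_isIdRigid_mapsTo`), every object being
RC-isomorphic to some `ℍ/Λ̄` (abc-iut-L4-t12's `RC.exists_iso_ofCover` + abc-iut-L4-t14's
`exists_iso_pslLocFunctor_obj`) and «mapping to `X`» not seeing `Q` (abc-iut-L4-t12's
`isIdRigid_mapsTo_fullSubcategory_iff`). [cite: MochizukiAbsTopIII2015, Proposition 4.2 (i) proof p.106] -/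
theorem RC.isIdRigid_EA_mapsTo_pslQuotient_of_isFreeGroup [IsFreeGroup Γ]
    [Finite (IsFreeGroup.Generators Γ)] (h2 : 2 ≤ Nat.card (IsFreeGroup.Generators Γ))
    (hN' : ∀ Λ : _root_.Literature.AnabelianGeometry.AbsoluteAnabelian.LocObj Γ,
      ((Λ.toSubgroup.map (toPGL (n := Fin 2) (R := ℝ))).subgroupOf
        (Subgroup.normalizer ((Λ.toSubgroup.map (toPGL (n := Fin 2) (R := ℝ)) : Subgroup PGL(2, ℝ)) :
          Set PGL(2, ℝ)))).FiniteIndex) :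
    IsIdRigid (geometricAutHolFieldFunctorRC fun Y : RC => Nonempty (Y ⟶ toRC.obj (pslQuotient Γ))).EA := by
  let Q : ObjectProperty RC := fun Y : RC => Nonempty (Y ⟶ toRC.obj (pslQuotient Γ))
  have hQ : ∀ {Y Z : RC}, (Y ⟶ Z) → Q Z → Q Y := fun f ⟨g⟩ => ⟨f ≫ g⟩
  change IsIdRigid Q.FullSubcategory
  refine isIdRigid_of_forall_isIdRigid_mapsTo fun X => ?_
  rw [isIdRigid_mapsTo_fullSubcategory_iff Q hQ X]
  -- `X ≅ ℍ/Λ̄` in `RC` for some finite-index `Λ̄ ≤ Γ̄`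
  obtain ⟨fX⟩ := X.property
  obtain ⟨eC, -, -⟩ := RC.exists_iso_ofCover (pslQuotient Γ) (Y := X.obj.of) fX
  obtain ⟨Λ, ⟨eΛ⟩⟩ := exists_iso_pslLocFunctor_obj Γ hfin
    ((pslQuotient Γ).ofCover fX.isFiniteEtale.isCoveringMap fX.isFiniteEtale.finite_fibre)
    ((pslQuotient Γ).ofCoverHom fX.isFiniteEtale.isCoveringMap fX.isFiniteEtale.finite_fibre)
  haveI : ProperlyDiscontinuousSMul Λ.toSubgroup ℍ :=
    Subgroup.properlyDiscontinuousSMul_of_le ‹ProperlyDiscontinuousSMul Γ ℍ› Λ.le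
  haveI : IsCancelSMul Λ.toSubgroup ℍ := isCancelSMul_of_le upperHalfPlane Γ Λ.le
  haveI := hN' Λ
  let i : toRC.obj (pslQuotient Λ.toSubgroup) ≅ X.obj := (toRC.mapIso eΛ).trans eC
  have hP : (fun Z : RC => Nonempty (Z ⟶ X.obj)) =
      fun Z : RC => Nonempty (Z ⟶ toRC.obj (pslQuotient Λ.toSubgroup)) := by
    funext Z
    exact propext ⟨fun ⟨f⟩ => ⟨f ≫ i.inv⟩, fun ⟨f⟩ => ⟨f ≫ i.hom⟩⟩
  rw [hP]
  obtain ⟨m, hm, ⟨e⟩⟩ := LocObj.exists_mulEquiv_freeGroup h2 Λ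
  exact RC.isIdRigid_mapsTo_pslQuotient_of_mulEquiv_freeGroup Λ.toSubgroup (hfin_of_locObj Γ hfin Λ) e hm


include hfin in
/-- ★ **[AbsTopIII] Cor 4.5 (i)–(v) for the archimedean log-Frobenius data over the geometric `EA` with
PRINT-FAITHFUL (RC-holomorphic) morphisms over `X₀ = ℍ/Γ̄`**, `Γ̄` free of rank `≥ 2`, under the single
finiteness hypothesis `[N_{PGL₂(ℝ)}(Λ̄) : Λ̄] < ∞` (abc-iut-L4-t10's `cor_4_5_geometricRC` over the
id-rigidity just proved). [cite: MochizukiAbsTopIII2015, Corollary 4.5 pp.107–109] -/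
theorem RC.cor_4_5_geometric_mapsTo_pslQuotient_of_isFreeGroup [IsFreeGroup Γ]
    [Finite (IsFreeGroup.Generators Γ)] (h2 : 2 ≤ Nat.card (IsFreeGroup.Generators Γ))
    (hN' : ∀ Λ : _root_.Literature.AnabelianGeometry.AbsoluteAnabelian.LocObj Γ,
      ((Λ.toSubgroup.map (toPGL (n := Fin 2) (R := ℝ))).subgroupOf
        (Subgroup.normalizer ((Λ.toSubgroup.map (toPGL (n := Fin 2) (R := ℝ)) : Subgroup PGL(2, ℝ)) :
          Set PGL(2, ℝ)))).FiniteIndex) :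
    Literature.AnabelianGeometry.AbsoluteAnabelian.AbsTopIII.Cor_4_5
      (archLogFrobeniusData
        (geometricAutHolFieldFunctorRC fun Y : RC => Nonempty (Y ⟶ toRC.obj (pslQuotient Γ))))
      (archTelecoreData
        (geometricAutHolFieldFunctorRC fun Y : RC => Nonempty (Y ⟶ toRC.obj (pslQuotient Γ)))) :=
  cor_4_5_geometricRC _ ⟨toRC.obj (pslQuotient Γ), ⟨𝟙 _⟩⟩
    (RC.isIdRigid_EA_mapsTo_pslQuotient_of_isFreeGroup Γ hfin h2 hN')

end H1

end HolRS

end Literature.AnabelianGeometry.AbsoluteAnabelian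

end
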